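import Summits.Ventures.HSemireg.WedgePointPairPowersKernelCollapse
import Summits.Ventures.HSemireg.WedgePointPairPowersKernelOneOne

/-!
# Venture HSemireg — the kernel on the `(1,1)`-plane for CURVE factors (`m = 1`, the `n`-fold box `Π_i (a·x_i + c·y_i)`): dimension
# `C(n+1, 2) = n(n+1)/2` — the `n` split pairs plus ONE line per pair of factors (every `n`)

HONEST FRAMING. Part of the Lean index of the computation cell `pub-hsemireg` (seat p10 gen 7, Sunday typer «UNIFORM-IN-n»).
Finite-dimensional EXTERIOR ALGEBRA over a field ONLY: no variety, no curve, no cohomology theory, no sheaf, no Ext group, no Hodge locus and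
no semiregularity map is constructed here; nothing here says that HC / HC_CM / HC_AV holds; no Literature fact is declared or used.
Custodian versions cited: STRUCTURE.md v1.0-SIGNED 9b196a05977dd067 §1.1 C4 / C5; theory/FORMULA-N.md PART A §2.2 (`P_1 = 1 + t`), §4.2.

`WedgePointPairPowersKernelOneOne.lean` (p10 g7): for `m ≥ 2` the kernel of `θ ↦ θ ∧ F` on the `(1,1)`-plane (degree-2 monomials with one
`X`- and one `Y`-letter) is the span of the split pairs, dimension `n·m²`.  THIS FILE is the remaining case `m = 1` (blocks `{x_i, y_i}`,
`F = Π_i (a·x_i + c·y_i)`), where the answer is DIFFERENT: the alive `(1,1)`-sets `{x_i, y_j}` and `{x_j, y_i}` (`i ≠ j`) both collapse onto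
the canonical set `{x_i, x_j}` (`WedgePointPairPowersKernelCollapse.canon`: the full half `Y_j = {y_j}` is traded for `X_j = {x_j}`), so their
images are proportional and ONE combination of them per pair `{i, j}` lies in the kernel.
* §1 (every `m ≥ 1`) the images `E_s ∧ F` of the CANONICAL alive `k`-sets are linearly independent (`linearIndependent_canon`: each is a
  non-zero multiple of its own class vector; the basis behind `card_canonSet = rank`);
* §2 (`m = 1`) the `X`-monomial `xx T = Π_{i ∈ T} x_i` of a set `T` of blocks (`xx`, canonical, `|T|` letters); the canonical representative of
  an alive `(1,1)`-set is `xx T` for the PAIR `T` of its two blocks (`canon_eq_xx_of_mem_ooAlive`); conversely for `i ≠ j` the `(1,1)`-set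
  `{x_i, y_j}` (`xy i j`) is alive with `canon = xx {i, j}` (`canon_xy`);
* §3 MAIN THEOREM (`m = 1`, every field, `n`, `a, c ≠ 0`): the range of `θ ↦ θ ∧ F` on the `(1,1)`-plane is the span of the `C(n,2)`
  independent vectors `xx T ∧ F`, `|T| = 2` (`range_phiOO_one`, **`finrank_range_phiOO_one = C(n,2)`**), hence by rank–nullity on the
  `n²`-dimensional plane **`finrank_ker_phiOO_one`: `dim ker = n² − C(n,2) = C(n+1,2) = n(n+1)/2`** (`sq_eq_choose_two_add`) — the `n`
  split pairs `x_i ∧ y_i` and, for each pair `i < j`, one combination of `x_i ∧ y_j` and `x_j ∧ y_i`.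
  QUOTED reading (not asserted): for the `n`-fold product of a curve (the cell's `Eⁿ`), the first-order locus inside
  `H¹(T) = H⁰(T) ⊗ H¹(𝒪)` (`n²`) where the box class `Π_i (a + c·pt_i)` — whose codimension-one part is the product principal
  polarisation — stays of type `(p,p)` is the `n(n+1)/2`-dimensional SYMMETRIC part: the Siegel directions; `n = 2`: `3` of `4`.
  With `WedgePointPairPowersKernelOneOne` the plane kernel is `n·m² + [m = 1]·C(n,2)` for every `m ≥ 1`, `n`.
NOT here: the Ext side; anything non-split.  Namespace `Summit.Ventures.HSemireg.Wedge.PairPowers`; new names only.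
-/

open Module Set Set.powersetCard Polynomial

namespace Summit.Ventures.HSemireg.Wedge.PairPowers

open Summit.Ventures.HSemireg.Wedge Summit.Ventures.HSemireg.Wedge.Kunneth

variable (K : Type*) [Field K] {m n : ℕ}

/-! ## §1. Canonical alive sets have independent images (every `m ≥ 1`) -/

/-- the source family of a canonical alive `k`-set: block `i ↦` its block part. -/
def cSrc {k : ℕ} (s : canonSet m n k) : Fin n → Opt m := fun i =>
  ⟨pb m n i s.1, mem_optSet_of_alive_ne ((mem_canonSet.mp s.2).1.2 i) ((mem_canonSet.mp s.2).2 i)⟩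

/-- its source is the set itself. -/
lemma src_cSrc {k : ℕ} (s : canonSet m n k) : src (cSrc s) = s.1 := biUnion_lift_pb s.1

/-- distinct canonical sets have distinct source families. -/
lemma cSrc_injective {k : ℕ} : Function.Injective (cSrc (m := m) (n := n) (k := k)) := fun s s' h =>
  Subtype.ext (by rw [← src_cSrc s, ← src_cSrc s', h])

/-- **the image of a canonical alive set is a non-zero multiple of its own class vector** (`m ≥ 1`, `a, c ≠ 0`). -/
lemma B_mul_pairBox_eq_smul_vec_cSrc (hm : 1 ≤ m) {a c : K} (ha : a ≠ 0) (hc : c ≠ 0) {k : ℕ} (s : canonSet m n k) :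
    ∃ μ : K, μ ≠ 0 ∧ B K (Fin ((m + m) * n)) s.1 * pairBox K (m := m) (n := n) a c = μ • vec K a c (cSrc s) := by
  obtain ⟨μ, hμ, e⟩ := B_mul_pairBox K hm ha hc s.1
  exact ⟨μ, hμ, by rw [e, vec, src_cSrc]⟩

/-- **the images `E_s ∧ F` of the canonical alive `k`-sets are linearly independent** (`m ≥ 1`, `a, c ≠ 0`; every `k`) — the basis of
the range behind `card_canonSet = [t^k]P_mⁿ = rank`. -/
theorem linearIndependent_canon (hm : 1 ≤ m) {a c : K} (ha : a ≠ 0) (hc : c ≠ 0) (k : ℕ) :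
    LinearIndependent K (fun s : canonSet m n k => B K (Fin ((m + m) * n)) s.1 * pairBox K (m := m) (n := n) a c) := by
  apply SurfacePowers.linearIndependent_of_disjoint_support
  · intro s
    obtain ⟨μ, hμ, e⟩ := B_mul_pairBox_eq_smul_vec_cSrc K hm ha hc s
    rw [e]
    exact smul_ne_zero hμ (vec_ne_zero K hm ha hc _)
  · intro s s' hne T
    obtain ⟨μ, -, e⟩ := B_mul_pairBox_eq_smul_vec_cSrc K hm ha hc s
    obtain ⟨μ', -, e'⟩ := B_mul_pairBox_eq_smul_vec_cSrc K hm ha hc s'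
    rw [e, e', map_smul, map_smul, smul_eq_mul, smul_eq_mul]
    rcases coord_vec_eq_zero_or K hm ha hc (fun h => hne (cSrc_injective h)) T with h0 | h0
    · exact Or.inl (by rw [h0, mul_zero])
    · exact Or.inr (by rw [h0, mul_zero])

/-! ## §2. Curve factors: the `X`-monomials `xx T` and the alive `(1,1)`-sets `{x_i, y_j}` -/

/-- for `m = 1` the halves are the singletons `X = {0}`, `Y = {1}` of `Fin 2`. -/
lemma Xs_one : Xs 1 = {0} := by
  ext j
  rw [WedgePair.mem_Xset, Finset.mem_singleton, Fin.ext_iff, Fin.val_zero]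
  omega

/-- … and `Y = {1}`. -/
lemma Ys_one : Ys 1 = {1} := by
  ext j
  rw [WedgePair.mem_Yset, Finset.mem_singleton, Fin.ext_iff]
  have := j.2
  rw [show ((1 : Fin (1 + 1)) : ℕ) = 1 from rfl]
  omega

/-- the same for th-7's spelling of the halves. -/
lemma Xset_one : WedgePair.Xset 1 = {0} := Xs_one

/-- … -/
lemma Yset_one : WedgePair.Yset 1 = {1} := Ys_one

/-- the halves of a curve factor are non-empty. -/
lemma Xs_one_ne_empty : Xs 1 ≠ ∅ := by
  rw [Xs_one]
  exact Finset.singleton_ne_empty _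

/-- … -/
lemma Ys_one_ne_empty : Ys 1 ≠ ∅ := by
  rw [Ys_one]
  exact Finset.singleton_ne_empty _

/-- an alive block part of a curve factor is `∅`, `X` or `Y`. -/
lemma alive_one_cases {t : Finset (Fin (1 + 1))} (ht : Disjoint t (Ys 1) ∨ Disjoint t (Xs 1)) : t = ∅ ∨ t = Xs 1 ∨ t = Ys 1 := by
  rw [WedgePair.disjoint_Y_iff_subset_X, WedgePair.disjoint_X_iff_subset_Y, Xset_one, Yset_one,
    Finset.subset_singleton_iff, Finset.subset_singleton_iff] at ht
  rw [Xs_one, Ys_one]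
  tauto

variable (n) in
/-- the `X`-MONOMIAL of a set `T` of blocks: the letters `x_i`, `i ∈ T`. -/
def xx (T : Finset (Fin n)) : Finset (Fin ((1 + 1) * n)) := glue fun i => if i ∈ T then Xs 1 else ∅

/-- block parts of `xx T`. -/
lemma pb_xx (T : Finset (Fin n)) (i : Fin n) : pb 1 n i (xx n T) = if i ∈ T then Xs 1 else ∅ := by
  unfold xx
  rw [pb_glue]

/-- `xx T` has `|T|` letters. -/
lemma card_xx (T : Finset (Fin n)) : (xx n T).card = T.card := by
  rw [card_eq_sum_card_pb (xx n T)]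
  simp_rw [pb_xx, apply_ite Finset.card, WedgePair.card_Xset, Finset.card_empty, Finset.sum_boole, Finset.filter_mem_eq_inter,
    Finset.univ_inter]
  rfl

/-- `xx` is injective. -/
lemma xx_injective : Function.Injective (xx n) := by
  intro T T' h
  ext i
  have h1 := pb_xx T i
  rw [h, pb_xx] at h1
  by_cases hi : i ∈ T <;> by_cases hi' : i ∈ T'
  · exact iff_of_true hi hi'
  · rw [if_pos hi, if_neg hi'] at h1
    exact absurd h1.symm Xs_one_ne_empty
  · rw [if_neg hi, if_pos hi'] at h1
    exact absurd h1 Xs_one_ne_empty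
  · exact iff_of_false hi hi'

/-- `xx T` is a canonical alive `|T|`-set. -/
lemma xx_mem_canonSet (T : Finset (Fin n)) : xx n T ∈ canonSet 1 n T.card := by
  rw [mem_canonSet]
  refine ⟨⟨card_xx T, fun i => ?_⟩, fun i => ?_⟩
  · rw [pb_xx]
    split_ifs
    · exact Or.inl (WedgePair.disjoint_XY 1)
    · exact Or.inl (Finset.disjoint_empty_left _)
  · rw [pb_xx]
    split_ifs
    · exact Xs_ne_Ys (le_refl 1)
    · rw [Ys_one]
      exact (Finset.singleton_ne_empty _).symm

/-- the BLOCKS of a monomial: those with a non-empty block part. -/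
def blocks (s : Finset (Fin ((1 + 1) * n))) : Finset (Fin n) := Finset.univ.filter fun i => pb 1 n i s ≠ ∅

/-- **the canonical representative of an alive `(1,1)`-set of curve factors is the `X`-monomial of its two blocks**. -/
theorem canon_eq_xx_of_mem_ooAlive {s : Finset (Fin ((1 + 1) * n))} (hs : s ∈ ooAlive 1 n) : canon s = xx n (blocks s) := by
  refine eq_of_pb_eq fun i => ?_
  have hi : i ∈ blocks s ↔ pb 1 n i s ≠ ∅ := by simp [blocks]
  rw [pb_canon, pb_xx]
  rcases alive_one_cases ((mem_ooAlive.mp hs).2 i) with h | h | h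
  · rw [if_neg (by rw [h]; exact fun e => Ys_one_ne_empty e.symm), if_neg (fun hb => hi.mp hb h), h]
  · rw [h, if_neg (Xs_ne_Ys (le_refl 1)), if_pos (hi.mpr (by rw [h]; exact Xs_one_ne_empty))]
  · rw [h, if_pos rfl, if_pos (hi.mpr (by rw [h]; exact Ys_one_ne_empty))]

/-- an alive `(1,1)`-set has exactly two blocks. -/
theorem card_blocks_of_mem_ooAlive {s : Finset (Fin ((1 + 1) * n))} (hs : s ∈ ooAlive 1 n) : (blocks s).card = 2 := by
  rw [← card_of_mem_ooSet (mem_ooAlive.mp hs).1, ← card_canon, canon_eq_xx_of_mem_ooAlive hs, card_xx]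

variable (n) in
/-- the `(1,1)`-set `{x_i, y_j}` as a glued monomial (meant for `i ≠ j`). -/
def xy (i j : Fin n) : Finset (Fin ((1 + 1) * n)) := glue fun k => if k = i then Xs 1 else if k = j then Ys 1 else ∅

/-- block parts of `{x_i, y_j}`. -/
lemma pb_xy (i j k : Fin n) : pb 1 n k (xy n i j) = if k = i then Xs 1 else if k = j then Ys 1 else ∅ := by
  unfold xy
  rw [pb_glue]

/-- `{x_i, y_j}` is the pair of the letters `x_i = (i, 0)` and `y_j = (j, 1)` (`i ≠ j`). -/
lemma xy_eq_pair {i j : Fin n} (hij : i ≠ j) : xy n i j = {blockEmb 1 n i 0, blockEmb 1 n j 1} := by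
  ext z
  rw [xy, glue, Finset.mem_biUnion, Finset.mem_insert, Finset.mem_singleton]
  constructor
  · rintro ⟨k, -, hk⟩
    obtain ⟨l, hl, rfl⟩ := mem_lift.mp hk
    by_cases hki : k = i
    · subst hki
      rw [if_pos rfl, Xs_one, Finset.mem_singleton] at hl
      exact Or.inl (by rw [hl])
    · by_cases hkj : k = j
      · subst hkj
        rw [if_neg hki, if_pos rfl, Ys_one, Finset.mem_singleton] at hl
        exact Or.inr (by rw [hl])
      · rw [if_neg hki, if_neg hkj] at hl
        exact absurd hl (Finset.notMem_empty _)
  · rintro (rfl | rfl)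
    · exact ⟨i, Finset.mem_univ _, mem_lift.mpr ⟨0, by rw [if_pos rfl, Xs_one]; exact Finset.mem_singleton_self _, rfl⟩⟩
    · exact ⟨j, Finset.mem_univ _, mem_lift.mpr ⟨1, by rw [if_neg hij.symm, if_pos rfl, Ys_one]; exact Finset.mem_singleton_self _, rfl⟩⟩

/-- **`{x_i, y_j}` (`i ≠ j`) is an alive `(1,1)`-set**. -/
theorem xy_mem_ooAlive {i j : Fin n} (hij : i ≠ j) : xy n i j ∈ ooAlive 1 n := by
  rw [mem_ooAlive]
  refine ⟨mem_ooSet.mpr ⟨_, (blockEmb_mem_XX_iff i 0).mpr (by rw [Xs_one]; exact Finset.mem_singleton_self _), _, fun h => ?_,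
    xy_eq_pair hij⟩, fun k => ?_⟩
  · have h1 := (blockEmb_mem_XX_iff j 1).mp h
    rw [Xs_one, Finset.mem_singleton] at h1
    exact absurd h1 (by decide)
  · rw [pb_xy]
    split_ifs
    · exact Or.inl (WedgePair.disjoint_XY 1)
    · exact Or.inr (WedgePair.disjoint_XY 1).symm
    · exact Or.inl (Finset.disjoint_empty_left _)

/-- **its canonical representative is `x_i x_j`**: the half `Y_j = {y_j}` collapses onto `X_j = {x_j}` (any `i`, `j`). -/
theorem canon_xy (i j : Fin n) : canon (xy n i j) = xx n {i, j} := by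
  refine eq_of_pb_eq fun k => ?_
  have hk : k ∈ ({i, j} : Finset (Fin n)) ↔ k = i ∨ k = j := by rw [Finset.mem_insert, Finset.mem_singleton]
  rw [pb_canon, pb_xy, pb_xx]
  by_cases hki : k = i
  · rw [if_pos hki, if_neg (Xs_ne_Ys (le_refl 1)), if_pos (hk.mpr (Or.inl hki))]
  · by_cases hkj : k = j
    · rw [if_neg hki, if_pos hkj, if_pos rfl, if_pos (hk.mpr (Or.inr hkj))]
    · rw [if_neg hki, if_neg hkj, if_neg (fun e => Ys_one_ne_empty e.symm), if_neg (fun h => (hk.mp h).elim hki hkj)]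

/-! ## §3. The range and the kernel on the `(1,1)`-plane for `m = 1` -/

/-- the `X`-monomials of the PAIRS of blocks, as canonical alive 2-sets. -/
def xxPair (T : (Finset.univ : Finset (Fin n)).powersetCard 2) : canonSet 1 n 2 :=
  ⟨xx n T.1, by
    have h := xx_mem_canonSet (n := n) T.1
    rwa [(Finset.mem_powersetCard.mp T.2).2] at h⟩

/-- `xxPair` is injective. -/
lemma xxPair_injective : Function.Injective (xxPair (n := n)) := fun _ _ h =>
  Subtype.ext (xx_injective (congr_arg Subtype.val h))

/-- **the range of `θ ↦ θ ∧ F` on the `(1,1)`-plane, `m = 1`: the span of the `x_i x_j ∧ F`, `i < j`** (`a, c ≠ 0`;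
`(xxPair T).1 = xx T`). -/
theorem range_phiOO_one {a c : K} (ha : a ≠ 0) (hc : c ≠ 0) :
    LinearMap.range (phiOO K (m := 1) (n := n) a c) =
      Submodule.span K (Set.range fun T : (Finset.univ : Finset (Fin n)).powersetCard 2 =>
        B K (Fin ((1 + 1) * n)) (xxPair T).1 * pairBox K (m := 1) (n := n) a c) := by
  have hm : 1 ≤ 1 := le_refl 1
  apply le_antisymm
  · -- the plane is spanned by the `(1,1)`-monomials; their images are `0` (split) or multiples of `xx (blocks) ∧ F`
    rw [phiOO, LinearMap.range_comp, Submodule.range_subtype, ooPlane, Submodule.map_span, Submodule.span_le]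
    rintro _ ⟨_, ⟨⟨s, hs⟩, rfl⟩, rfl⟩
    rw [SetLike.mem_coe, LinearMap.mulRight_apply]
    by_cases hal : ∀ i : Fin n, Disjoint (pb 1 n i s) (Ys 1) ∨ Disjoint (pb 1 n i s) (Xs 1)
    · have hsA : s ∈ ooAlive 1 n := mem_ooAlive.mpr ⟨hs, hal⟩
      obtain ⟨-, e⟩ := ccoef_spec K hm ha hc s
      rw [e, canon_eq_xx_of_mem_ooAlive hsA]
      refine Submodule.smul_mem _ _ (Submodule.subset_span ⟨⟨blocks s, ?_⟩, rfl⟩)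
      exact Finset.mem_powersetCard.mpr ⟨Finset.subset_univ _, card_blocks_of_mem_ooAlive hsA⟩
    · rw [B_mul_pairBox_eq_zero_of_not_alive K hm ha hc hal]
      exact Submodule.zero_mem _
  · -- conversely `xx {i,j} ∧ F` is a multiple of the image of the plane vector `{x_i, y_j}`
    rw [Submodule.span_le]
    rintro _ ⟨⟨T, hT⟩, rfl⟩
    obtain ⟨-, hT2⟩ := Finset.mem_powersetCard.mp hT
    obtain ⟨i, j, hij, rfl⟩ := Finset.card_eq_two.mp hT2
    obtain ⟨hl, e⟩ := ccoef_spec K hm ha hc (xy n i j)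
    rw [canon_xy] at e
    have hmem : B K (Fin ((1 + 1) * n)) (xy n i j) ∈ ooPlane K 1 n :=
      Submodule.subset_span ⟨⟨xy n i j, (mem_ooAlive.mp (xy_mem_ooAlive hij)).1⟩, rfl⟩
    refine ⟨(ccoef K a c (xy n i j))⁻¹ • ⟨_, hmem⟩, ?_⟩
    rw [map_smul, phiOO_apply, e, smul_smul, inv_mul_cancel₀ hl, one_smul]
    rfl

/-- **rank on the `(1,1)`-plane, `m = 1`: `C(n, 2)`** — one class `x_i x_j ∧ F` per pair of factors. -/
theorem finrank_range_phiOO_one {a c : K} (ha : a ≠ 0) (hc : c ≠ 0) :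
    finrank K (LinearMap.range (phiOO K (m := 1) (n := n) a c)) = n.choose 2 := by
  rw [range_phiOO_one K ha hc, finrank_span_eq_card, Fintype.card_coe, Finset.card_powersetCard, Finset.card_univ, Fintype.card_fin]
  exact (linearIndependent_canon K (le_refl 1) ha hc 2).comp xxPair xxPair_injective

/-- `n² = C(n,2) + C(n+1,2)`. -/
lemma sq_eq_choose_two_add (n : ℕ) : n * n = n.choose 2 + (n + 1).choose 2 := by
  induction n with
  | zero => simp
  | succ n ih =>
    have h1 : (n + 1 + 1).choose 2 = (n + 1) + (n + 1).choose 2 := by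
      rw [Nat.choose_succ_succ (n + 1) 1, Nat.choose_one_right]
    have h2 : (n + 1).choose 2 = n + n.choose 2 := by
      rw [Nat.choose_succ_succ n 1, Nat.choose_one_right]
    rw [h1, h2]
    nlinarith [ih, h2]

/-- **MAIN THEOREM, `m = 1` (curve factors), every field, `n`, `a, c ≠ 0: `dim ker(θ ↦ θ ∧ F ∣ (1,1)-plane) = C(n+1, 2) = n(n+1)/2`** —
the `n` split pairs `x_i ∧ y_i` and one line per pair `i < j` (a combination of `x_i ∧ y_j` and `x_j ∧ y_i`, both collapsing onto
`x_i x_j`); in the quoted dictionary the SYMMETRIC (Siegel) directions inside `H¹(T_{Cⁿ})`. -/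
theorem finrank_ker_phiOO_one {a c : K} (ha : a ≠ 0) (hc : c ≠ 0) :
    finrank K (LinearMap.ker (phiOO K (m := 1) (n := n) a c)) = (n + 1).choose 2 := by
  have h := LinearMap.finrank_range_add_finrank_ker (phiOO K (m := 1) (n := n) a c)
  rw [finrank_ooPlane, finrank_range_phiOO_one K ha hc, one_mul] at h
  have h2 := sq_eq_choose_two_add n
  omega

/-- … `= n + C(n,2)`: the split pairs plus one line per pair of factors. -/
theorem finrank_ker_phiOO_one' {a c : K} (ha : a ≠ 0) (hc : c ≠ 0) :
    finrank K (LinearMap.ker (phiOO K (m := 1) (n := n) a c)) = n + n.choose 2 := by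
  rw [finrank_ker_phiOO_one K ha hc, Nat.choose_succ_succ n 1, Nat.choose_one_right]

/-- two curve factors (`C × C′`, `n = 2`): the plane `H¹(T)` has `4` dimensions and the kernel `3` (= `dim` of the Siegel space `𝔥₂`). -/
theorem finrank_ker_phiOO_one_two {a c : K} (ha : a ≠ 0) (hc : c ≠ 0) :
    finrank K (LinearMap.ker (phiOO K (m := 1) (n := 2) a c)) = 3 ∧ finrank K (ooPlane K 1 2) = 4 := by
  rw [finrank_ker_phiOO_one K ha hc, finrank_ooPlane]
  exact ⟨by decide, by decide⟩

end Summit.Ventures.HSemireg.Wedge.PairPowers
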